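import Literature.Geometry.Kaehler.RiemannSurfaceArcWeakSolutions
import Literature.Geometry.Kaehler.RiemannSurfaceMeromorphicOneFormNormalForm
import Literature.Geometry.Kaehler.RiemannSurfaceThirdKindDifferentials
import HarnessLib

/-!
# The closed form of an arc: a smooth closed `1`-form `β = P dz + σ` completing the `(0,1)`-form
# `σ` of a weak solution (Forster §20.5–20.7, with a differential of the third kind)

Layer `Literature/Geometry/Kaehler`, sequel of `RiemannSurfaceArcWeakSolutions` (an arc `A` in a
chart of a Riemann surface `M`, its cut-off `ρ`, cut logarithm `w = w_{a,b}`, weak solution `f` and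
smooth `(0,1)`-form `σ = (∂̄ρ · w) dz̄_p`). O. Forster, *Lectures on Riemann Surfaces*, GTM 81 (1981):
in the proof of Theorem 20.7 (Abel's theorem, sufficiency) the form `σ` of a weak solution `f` of
`∂c` is shown to satisfy `∬ σ ∧ ω = 0` for all holomorphic `ω` and then, by Dolbeault's lemma and
19.10, `σ = d″ψ`. The tree replaces 19.10 by the de Rham Hodge decomposition of `H¹(M, ℂ)`
(`RiemannSurfaceHodgeDecompositionH1.exists_eq_oneZeroForm_add_mextDeriv_of_wedge_exact`), which is
fed a CLOSED smooth `1`-form whose `(0,1)`-part is `σ`. This file constructs it for one arc: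

  `β = (2πi)⁻¹ (f⁻¹ df - τ)` on `M ∖ {a', b'}`, extended smoothly across the endpoints,

where `τ` is an abelian differential of the third kind with simple poles of residue `+1` at `b'` and
`-1` at `a'`, holomorphic elsewhere (Farkas–Kra III.3.5 (3.5.1), the tree's `exists_thirdKind`,
normalised by `exists_isNormalFormAt_sub_eq_top`). Concretely, in the chart `z_p` (with
`λ = (z-b)⁻¹ - (z-a)⁻¹ = 2πi w′`): `(2πi)⁻¹ f⁻¹ df = w dρ + (2πi)⁻¹ ρλ dz`, so

  `β = (w ∂ρ + (2πi)⁻¹ K) dz_p + (w ∂̄ρ) dz̄_p`,   `K = ρλ - τ_{z_p}` (poles at `a, b` removable),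

and off the chart `β = -(2πi)⁻¹ τ`. Contents:

* §1 plane lemmas for the Wirtinger operator `∂ = delAlong 1`: Leibniz, `∂∂̄ = ∂̄∂`
  (`delAlong_dbarAlong_comm`), and the structure of a simple pole with given residue
  (`exists_analyticAt_eventuallyEq_inv_mul`);
* §2 `ThirdKindFor A τ` (an adapted differential of the third kind) and its existence on a compact
  connected surface (`exists_thirdKindFor`); its local expression in `z_p` near the poles;
* §3 the completed coefficient `K` (`kappa`): analytic on the disc `B(c₀, r₂)` (`analyticAt_kappa`),
  `C^∞` on the chart target, `∂̄K = λ ∂̄ρ` (`dbarAlong_kappa`);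
* §4 `P̃ = w ∂ρ + (2πi)⁻¹ K` and the closedness identity **`∂q = ∂̄P̃`** for `q = ∂̄ρ · w`
  (`delAlong_coeff_eq_dbarAlong_Ptilde`: both sides are `w ∂∂̄ρ + (2πi)⁻¹ λ ∂̄ρ`);
* §5 the form **`closedForm τ = P dz + σ`**, its chart representative `P̃ dz + q dz̄`, smoothness
  (`isSmoothForm_closedForm`), closedness (`mextDeriv_closedForm`, via Forster 9.13 in the chart and
  holomorphy of `τ` off it), and the packaged statement **`exists_closedForm`**: a smooth closed `β`
  with `β = P dz + σ`.

Everything is proved; the definitions have bodies; `ThirdKindFor` is a `Prop`-valued structure; no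
named facts, no instances.

## References

* O. Forster, *Lectures on Riemann Surfaces*, GTM 81, Springer (1981), §20.5 (proof, part (a)),
  Theorem 20.7 (proof), §9.13. [Forster1981]
* H. M. Farkas, I. Kra, *Riemann Surfaces*, GTM 71, 2nd ed. (1992), III.3.5 (3.5.1) (differentials
  of the third kind `τ_{PQ}`). [FarkasKra1992]
* R. Miranda, *Algebraic Curves and Riemann Surfaces*, GSM 5 (1995), Chapter IV Definitions 1.7, 3.11.
  [Miranda1995]
* L. Hörmander, *An Introduction to Complex Analysis in Several Variables* (1973), §1.1.
  [HormanderSCV1973]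
-/

noncomputable section

open scoped Manifold ContDiff Topology ComplexConjugate Real
open Set Filter Function Complex Metric MeasureTheory
open Literature.NumberTheory.Transcendental Literature.Analysis.Complex

namespace Literature.Geometry.Kaehler

/-! ### §1 Plane lemmas: the operator `∂`, mixed Wirtinger derivatives, simple poles -/

section Plane

/-- `∂c = Dc[1] - ∂̄c` (the real derivative in the direction `1` splits as `∂ + ∂̄`).
[cite: HormanderSCV1973, §1.1] -/
theorem delAlong_eq_fderiv_sub_dbarAlong (c : ℂ → ℂ) (y : ℂ) :
    delAlong 1 c y = fderiv ℝ c y 1 - dbarAlong 1 c y := by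
  have h := fderiv_apply_eq_delAlong_add_dbarAlong c y 1
  rw [map_one (starRingEnd ℂ), mul_one, mul_one] at h
  rw [h]
  ring

/-- `∂` depends only on the germ. [cite: HormanderSCV1973, §1.1] -/
theorem delAlong_congr_of_eventuallyEq {u w : ℂ → ℂ} {x : ℂ} (h : u =ᶠ[𝓝 x] w) :
    delAlong 1 u x = delAlong 1 w x := by
  rw [delAlong_eq_fderiv_sub_dbarAlong, delAlong_eq_fderiv_sub_dbarAlong, h.fderiv_eq,
    dbarAlong_congr_of_eventuallyEq h 1]

/-- `∂` of a constant vanishes. [cite: HormanderSCV1973, §1.1] -/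
theorem delAlong_const' (c y : ℂ) : delAlong 1 (fun _ : ℂ ↦ c) y = 0 := by
  simp [delAlong_apply, fderiv_const_apply]

/-- **Leibniz rule for `∂`**: `∂(ab) = (∂a) b + a (∂b)`. [cite: HormanderSCV1973, §1.1] -/
theorem delAlong_one_mul {a b : ℂ → ℂ} {z : ℂ} (ha : DifferentiableAt ℝ a z)
    (hb : DifferentiableAt ℝ b z) :
    delAlong 1 (fun w ↦ a w * b w) z = delAlong 1 a z * b z + a z * delAlong 1 b z := by
  rw [delAlong_eq_fderiv_sub_dbarAlong, delAlong_eq_fderiv_sub_dbarAlong,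
    delAlong_eq_fderiv_sub_dbarAlong, dbarAlong_one_mul ha hb, fderiv_fun_mul ha hb]
  change a z * fderiv ℝ b z 1 + b z * fderiv ℝ a z 1 - _ = _
  ring

/-- `∂(c · a) = c ∂a` for a constant `c`. [cite: HormanderSCV1973, §1.1] -/
theorem delAlong_const_mul {a : ℂ → ℂ} {z : ℂ} (ha : DifferentiableAt ℝ a z) (c : ℂ) :
    delAlong 1 (fun w ↦ c * a w) z = c * delAlong 1 a z := by
  rw [delAlong_one_mul (differentiableAt_const c) ha, delAlong_const', zero_mul, zero_add]

/-- `∂̄(c · a) = c ∂̄a` for a constant `c`. [cite: HormanderSCV1973, §1.1] -/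
theorem dbarAlong_const_mul' {a : ℂ → ℂ} {z : ℂ} (ha : DifferentiableAt ℝ a z) (c : ℂ) :
    dbarAlong 1 (fun w ↦ c * a w) z = c * dbarAlong 1 a z := by
  rw [dbarAlong_one_mul (differentiableAt_const c) ha,
    dbarAlong_eq_zero_of_differentiableAt (differentiableAt_const c) 1, zero_mul, zero_add]

/-- `∂` of a `C^∞` function is `C^∞`. [cite: HormanderSCV1973, §1.1] -/
theorem contDiff_delAlong {u : ℂ → ℂ} (hu : ContDiff ℝ ∞ u) : ContDiff ℝ ∞ (delAlong 1 u) := by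
  have h : delAlong 1 u = fun y ↦ fderiv ℝ u y 1 - dbarAlong 1 u y :=
    funext fun y ↦ delAlong_eq_fderiv_sub_dbarAlong u y
  rw [h]
  exact ((contDiff_infty_iff_fderiv.1 hu).2.clm_apply contDiff_const).sub (contDiff_infty_dbarAlong hu 1)

/-- **The mixed Wirtinger derivatives commute: `∂∂̄ρ = ∂̄∂ρ`** for `ρ` of class `C²` at the point
(symmetry of the second derivative; Hörmander §1.1, `∂²/∂z∂z̄ = ¼Δ`). [cite: HormanderSCV1973, §1.1] -/
theorem delAlong_dbarAlong_comm {ρ : ℂ → ℂ} {z : ℂ} {n : WithTop ℕ∞} (hρ : ContDiffAt ℝ n ρ z)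
    (hn : 2 ≤ n) : delAlong 1 (dbarAlong 1 ρ) z = dbarAlong 1 (delAlong 1 ρ) z := by
  have hd : DifferentiableAt ℝ (fderiv ℝ ρ) z :=
    (hρ.fderiv_right (m := 1) (by simpa [one_add_one_eq_two] using hn)).differentiableAt one_ne_zero
  -- `∂̄ρ` and `Dρ[1]` are differentiable at `z`
  have h1 : ∀ w' : ℂ, HasFDerivAt (fun y ↦ fderiv ℝ ρ y w') ((fderiv ℝ (fderiv ℝ ρ) z).flip w') z :=
    fun w' ↦ by simpa using hd.hasFDerivAt.clm_apply (hasFDerivAt_const w' z)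
  have hD1 : DifferentiableAt ℝ (fun y ↦ fderiv ℝ ρ y 1) z := (h1 1).differentiableAt
  have hdbar : DifferentiableAt ℝ (dbarAlong 1 ρ) z := by
    have h2 : HasFDerivAt (dbarAlong 1 ρ) ((2 : ℂ)⁻¹ • ((fderiv ℝ (fderiv ℝ ρ) z).flip 1 +
        I • (fderiv ℝ (fderiv ℝ ρ) z).flip (I • 1))) z := by
      unfold dbarAlong
      exact ((h1 1).add ((h1 (I • 1)).const_smul I)).const_smul (2 : ℂ)⁻¹
    exact h2.differentiableAt
  have hdel : delAlong 1 ρ = fun y ↦ fderiv ℝ ρ y 1 - dbarAlong 1 ρ y :=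
    funext fun y ↦ delAlong_eq_fderiv_sub_dbarAlong ρ y
  rw [delAlong_eq_fderiv_sub_dbarAlong, hdel, dbarAlong_sub hD1 hdbar]
  congr 1
  -- `D(∂̄ρ)(z)[1] = ∂̄(Dρ[1])(z)` by the symmetry of `D²ρ(z)`
  have hs : IsSymmSndFDerivAt ℝ ρ z := hρ.isSymmSndFDerivAt (by simpa using hn)
  rw [fderiv_dbarAlong_apply hρ hn 1 1, dbarAlong_one, (h1 1).fderiv]
  simp only [ContinuousLinearMap.flip_apply, smul_eq_mul, mul_one]
  rw [hs 1 I]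

/-- `dslope` of an analytic function is analytic (the power series `p.fslope`).
[cite: Miranda1995, Chapter IV Definition 3.11] -/
private theorem AnalyticAt.dslope' {G : ℂ → ℂ} {b : ℂ} (hG : AnalyticAt ℂ G b) :
    AnalyticAt ℂ (dslope G b) b := by
  obtain ⟨p, hp⟩ := hG
  exact ⟨_, hp.has_fpower_series_dslope_fslope⟩

/-- **A simple pole with prescribed residue**: if `f` is meromorphic at `c` of order `-1` with residue
`r`, then `f = (z - c)⁻¹ G` on a punctured neighbourhood with `G` analytic at `c` and `G(c) = r`.
[cite: Miranda1995, Chapter IV Definition 3.11] -/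
theorem exists_analyticAt_eventuallyEq_inv_mul {f : ℂ → ℂ} {c r : ℂ} (hf : MeromorphicAt f c)
    (hord : meromorphicOrderAt f c = (-1 : ℤ)) (hres : residueAt f c = r) :
    ∃ G : ℂ → ℂ, AnalyticAt ℂ G c ∧ G c = r ∧ f =ᶠ[𝓝[≠] c] fun z ↦ (z - c)⁻¹ * G z := by
  obtain ⟨G, hGa, hG0, hfG⟩ := (meromorphicOrderAt_eq_int_iff hf).1 hord
  have hfG' : f =ᶠ[𝓝[≠] c] fun z ↦ (z - c)⁻¹ * G z := by
    filter_upwards [hfG] with z hz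
    rw [hz, zpow_neg, zpow_one, smul_eq_mul]
  refine ⟨G, hGa, ?_, hfG'⟩
  -- the residue of `(z - c)⁻¹ G` is `G c`: principal part `G(c) (z-c)⁻¹ + dslope G c`
  have hpp : ∀ᶠ z in 𝓝[≠] c, f z =
      (∑ k ∈ Finset.range 1, (fun _ ↦ G c) k * (z - c) ^ (-(k + 1 : ℤ))) + dslope G c z := by
    filter_upwards [hfG', self_mem_nhdsWithin] with z hz hzc
    rw [hz, Finset.sum_range_one, dslope_of_ne _ hzc, slope_def_field]
    simp only [Nat.cast_zero, zero_add, zpow_neg, zpow_one]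
    have hzc' : z - c ≠ 0 := sub_ne_zero.2 hzc
    field_simp
    ring
  have h := residueAt_eq_of_principalPart (AnalyticAt.dslope' hGa) hpp
  rw [if_pos one_pos] at h
  rw [← hres, h]

end Plane


namespace RiemannSurface

namespace ArcDatum

variable {M : Type*} [TopologicalSpace M] [ChartedSpace ℂ M] [IsManifold 𝓘(ℂ, ℂ) ω M]
  (A : ArcDatum M)

/-! ### §2 A differential of the third kind adapted to the arc -/

/-- **A differential of the third kind adapted to the arc**: a meromorphic `1`-form `τ` on `M`,
holomorphic (in normal form) off the endpoints, with simple poles of residue `+1` at `b'` and `-1`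
at `a'` — Forster's / Farkas–Kra's `τ_{PQ}` for `P = b'`, `Q = a'`.
[cite: FarkasKra1992, III.3.5 (3.5.1)] -/
structure ThirdKindFor (τ : MeromorphicOneForm M) : Prop where
  holo : ∀ x, x ≠ A.srcPt → x ≠ A.tgtPt → τ.IsHolomorphicAt x
  order_tgtPt : τ.meromorphicOrderAt A.tgtPt = (-1 : ℤ)
  residue_tgtPt : τ.residue A.tgtPt = 1
  order_srcPt : τ.meromorphicOrderAt A.srcPt = (-1 : ℤ)
  residue_srcPt : τ.residue A.srcPt = -1

/-- **Existence of an adapted differential of the third kind** on a compact connected Riemann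
surface (the tree's `exists_thirdKind`, normalised by `exists_isNormalFormAt_sub_eq_top` so that it is
genuinely holomorphic off the endpoints). [cite: FarkasKra1992, III.3.5 (3.5.1)] -/
theorem exists_thirdKindFor [CompactSpace M] [T2Space M] [PreconnectedSpace M] [Nonempty M] :
    ∃ τ : MeromorphicOneForm M, A.ThirdKindFor τ := by
  obtain ⟨τ, hres1, hres2, hord1, hord2, hreg, -, -⟩ := exists_thirdKind A.srcPt_ne_tgtPt.symm
  obtain ⟨τ', hnf, htop⟩ := MeromorphicOneForm.exists_isNormalFormAt_sub_eq_top (η := τ)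
  have hord : ∀ p, τ'.meromorphicOrderAt p = τ.meromorphicOrderAt p := fun p ↦
    MeromorphicOneForm.meromorphicOrderAt_eq_of_sub_eq_top τ htop p
  have hres : ∀ p, τ'.residue p = τ.residue p := fun p ↦
    (MeromorphicOneForm.residue_eq_of_meromorphicOrderAt_sub_eq_top (htop p)).symm
  refine ⟨τ', ⟨fun x h1 h2 ↦ ?_, ?_, ?_, ?_, ?_⟩⟩
  · rw [(hnf x).isHolomorphicAt_iff, hord]
    exact hreg x h2 h1
  · rw [hord]; exact hord1
  · rw [hres]; exact hres1
  · rw [hord]; exact hord2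
  · rw [hres]; exact hres2

variable {A} {τ : MeromorphicOneForm M}

/-- In the chart `z_p` the local expression of an adapted `τ` is analytic at every point of the
target other than `a, b`. [cite: Miranda1995, Chapter IV Definitions 1.1, 1.7] -/
theorem ThirdKindFor.analyticAt_localExpr (hτ : A.ThirdKindFor τ) {z : ℂ}
    (hz : z ∈ (chartAt ℂ A.center).target) (h1 : z ≠ A.src) (h2 : z ≠ A.tgt) :
    AnalyticAt ℂ (τ.localExpr (chartAt ℂ A.center)) z := by
  have hx : (chartAt ℂ A.center).symm z ∈ (chartAt ℂ A.center).source :=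
    (chartAt ℂ A.center).map_target hz
  have hne1 : (chartAt ℂ A.center).symm z ≠ A.srcPt := fun h ↦ h1 (by
    rw [← (chartAt ℂ A.center).right_inv hz, h, chartAt_srcPt])
  have hne2 : (chartAt ℂ A.center).symm z ≠ A.tgtPt := fun h ↦ h2 (by
    rw [← (chartAt ℂ A.center).right_inv hz, h, chartAt_tgtPt])
  have h := (hτ.holo _ hne1 hne2).analyticAt_localExpr
    (mdifferentiableOn_atlas_symm (I := 𝓘(ℂ, ℂ)) (chart_mem_atlas ℂ A.center)) hx
  rwa [(chartAt ℂ A.center).right_inv hz] at h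

/-- **The simple pole of `τ` at `b'` read in the chart `z_p`**: `τ_{z_p} = (z - b)⁻¹ G` near `b`
with `G` analytic, `G(b) = 1`. [cite: Miranda1995, Chapter IV Definition 3.11] -/
theorem ThirdKindFor.exists_eventuallyEq_tgt (hτ : A.ThirdKindFor τ) :
    ∃ G : ℂ → ℂ, AnalyticAt ℂ G A.tgt ∧ G A.tgt = 1 ∧
      τ.localExpr (chartAt ℂ A.center) =ᶠ[𝓝[≠] A.tgt] fun z ↦ (z - A.tgt)⁻¹ * G z := by
  refine exists_analyticAt_eventuallyEq_inv_mul
    (τ.meromorphicAt_localExpr (mdifferentiableOn_atlas_symm (I := 𝓘(ℂ, ℂ))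
      (chart_mem_atlas ℂ A.center)) A.tgt_mem_target) ?_ ?_
  · rw [τ.meromorphicOrderAt_localExpr_of_mem_target (chart_mem_atlas ℂ A.center) A.tgt_mem_target]
    exact hτ.order_tgtPt
  · rw [τ.residueAt_localExpr_of_mem_target (chart_mem_atlas ℂ A.center) A.tgt_mem_target]
    exact hτ.residue_tgtPt

/-- **The simple pole of `τ` at `a'` read in the chart `z_p`**: `τ_{z_p} = (z - a)⁻¹ G` near `a`
with `G` analytic, `G(a) = -1`. [cite: Miranda1995, Chapter IV Definition 3.11] -/
theorem ThirdKindFor.exists_eventuallyEq_src (hτ : A.ThirdKindFor τ) :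
    ∃ G : ℂ → ℂ, AnalyticAt ℂ G A.src ∧ G A.src = -1 ∧
      τ.localExpr (chartAt ℂ A.center) =ᶠ[𝓝[≠] A.src] fun z ↦ (z - A.src)⁻¹ * G z := by
  refine exists_analyticAt_eventuallyEq_inv_mul
    (τ.meromorphicAt_localExpr (mdifferentiableOn_atlas_symm (I := 𝓘(ℂ, ℂ))
      (chart_mem_atlas ℂ A.center)) A.src_mem_target) ?_ ?_
  · rw [τ.meromorphicOrderAt_localExpr_of_mem_target (chart_mem_atlas ℂ A.center) A.src_mem_target]
    exact hτ.order_srcPt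
  · rw [τ.residueAt_localExpr_of_mem_target (chart_mem_atlas ℂ A.center) A.src_mem_target]
    exact hτ.residue_srcPt

/-! ### §3 The completed `(1,0)`-coefficient `K` of `(2πi) β₂ = ρλ dz_p - τ` -/

variable (A)

/-- `λ(z) = (z - b)⁻¹ - (z - a)⁻¹ = 2πi · w_{a,b}′(z)`, the logarithmic derivative of `(z-b)/(z-a)`.
[cite: Forster1981, §20.5, proof (a)] -/
def lam : ℂ → ℂ := fun z ↦ (z - A.tgt)⁻¹ - (z - A.src)⁻¹

/-- The raw coefficient `ρλ - τ_{z_p}` (singular values at `a, b`). [cite: Forster1981, §20.5, proof (a)] -/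
def kappa₀ (τ : MeromorphicOneForm M) : ℂ → ℂ := fun z ↦
  A.cutoff z * A.lam z - τ.localExpr (chartAt ℂ A.center) z

open Classical in
/-- **The completed coefficient `K`**: `ρλ - τ_{z_p}` with its removable singularities at `a, b`
filled in by the punctured limits. [cite: Forster1981, §20.5, proof (a)] -/
def kappa (τ : MeromorphicOneForm M) : ℂ → ℂ := fun z ↦
  if z = A.tgt ∨ z = A.src then limUnder (𝓝[≠] z) (A.kappa₀ τ) else A.kappa₀ τ z

omit [IsManifold 𝓘(ℂ, ℂ) ω M] in
/-- `λ` is holomorphic off `{a, b}`. [cite: Forster1981, §20.5, proof (a)] -/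
theorem differentiableAt_lam {z : ℂ} (h1 : z ≠ A.src) (h2 : z ≠ A.tgt) :
    DifferentiableAt ℂ A.lam z :=
  ((differentiableAt_id.sub_const A.tgt).inv (sub_ne_zero.2 h2)).sub
    ((differentiableAt_id.sub_const A.src).inv (sub_ne_zero.2 h1))

omit [IsManifold 𝓘(ℂ, ℂ) ω M] in
/-- `λ` is analytic off `{a, b}`. [cite: Forster1981, §20.5, proof (a)] -/
theorem analyticAt_lam {z : ℂ} (h1 : z ≠ A.src) (h2 : z ≠ A.tgt) : AnalyticAt ℂ A.lam z := by
  have hopen : IsOpen ({A.src, A.tgt}ᶜ : Set ℂ) := (Set.toFinite _).isClosed.isOpen_compl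
  have hz : z ∈ ({A.src, A.tgt}ᶜ : Set ℂ) := by simp [h1, h2]
  exact (DifferentiableOn.analyticAt (s := ({A.src, A.tgt}ᶜ : Set ℂ))
    (fun w hw ↦ (A.differentiableAt_lam (fun h ↦ hw (by simp [h])) (fun h ↦ hw (by simp [h])))
      |>.differentiableWithinAt) (hopen.mem_nhds hz))

omit [IsManifold 𝓘(ℂ, ℂ) ω M] in
/-- `w_{a,b}′ = (2πi)⁻¹ λ` off the cut. [cite: Forster1981, §20.5, proof (a)] -/
theorem deriv_arcLog_eq {z : ℂ} (hz : z ∉ segment ℝ A.src A.tgt) :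
    deriv (arcLog A.src A.tgt) z = (2 * π * I)⁻¹ * A.lam z :=
  (hasDerivAt_arcLog hz).deriv

omit [IsManifold 𝓘(ℂ, ℂ) ω M] in
/-- Points off `B(c₀, r₂)` are off the cut and differ from `a, b`. [cite: Forster1981, §20.5, proof (a)] -/
theorem not_mem_segment_of_not_mem_ball {z : ℂ} (hz : z ∉ ball A.c₀ A.r₂) :
    z ∉ segment ℝ A.src A.tgt := fun h ↦
  hz (ball_subset_ball A.r₀_lt_r₂.le ((convex_ball A.c₀ A.r₀).segment_subset A.src_mem A.tgt_mem h))

omit [IsManifold 𝓘(ℂ, ℂ) ω M] in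
/-- `a ∈ B(c₀, r₂)`. [cite: Forster1981, §20.5, proof (a)] -/
theorem src_mem_ball_r₂ : A.src ∈ ball A.c₀ A.r₂ := ball_subset_ball A.r₀_lt_r₂.le A.src_mem

omit [IsManifold 𝓘(ℂ, ℂ) ω M] in
/-- `b ∈ B(c₀, r₂)`. [cite: Forster1981, §20.5, proof (a)] -/
theorem tgt_mem_ball_r₂ : A.tgt ∈ ball A.c₀ A.r₂ := ball_subset_ball A.r₀_lt_r₂.le A.tgt_mem

omit [IsManifold 𝓘(ℂ, ℂ) ω M] in
/-- The disc `B(c₀, r₂)` lies in the chart target. [cite: Forster1981, §20.5, proof (a)] -/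
theorem ball_r₂_subset_target : ball A.c₀ A.r₂ ⊆ (chartAt ℂ A.center).target :=
  (ball_subset_ball (A.r₂_lt_r₃.trans A.r₃_lt_R).le).trans A.ball_subset_target

omit [IsManifold 𝓘(ℂ, ℂ) ω M] in
/-- The cut-off is eventually `1` near a point of `B(c₀, r₂)`. [cite: Forster1981, §20.5, proof (a)] -/
theorem cutoff_eventuallyEq_one {z : ℂ} (hz : z ∈ ball A.c₀ A.r₂) :
    A.cutoff =ᶠ[𝓝 z] fun _ ↦ 1 := by
  filter_upwards [isOpen_ball.mem_nhds hz] with w hw using A.cutoff_eq_one hw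

omit [IsManifold 𝓘(ℂ, ℂ) ω M] in
/-- `∂̄ρ = 0` on `B(c₀, r₂)`. [cite: Forster1981, §20.5, proof (a)] -/
theorem dbarAlong_cutoff_eq_zero {z : ℂ} (hz : z ∈ ball A.c₀ A.r₂) : dbarAlong 1 A.cutoff z = 0 :=
  dbarAlong_eq_zero_of_eqOn_ball (fun _ h ↦ A.cutoff_eq_one h) hz

omit [IsManifold 𝓘(ℂ, ℂ) ω M] in
/-- `∂ρ = 0` on `B(c₀, r₂)`. [cite: Forster1981, §20.5, proof (a)] -/
theorem delAlong_cutoff_eq_zero {z : ℂ} (hz : z ∈ ball A.c₀ A.r₂) : delAlong 1 A.cutoff z = 0 := by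
  rw [delAlong_eq_fderiv_sub_dbarAlong, A.dbarAlong_cutoff_eq_zero hz, sub_zero,
    (A.cutoff_eventuallyEq_one hz).fderiv_eq, fderiv_const_apply]
  rfl

omit [IsManifold 𝓘(ℂ, ℂ) ω M] in
/-- `∂ρ = 0` and `∂̄ρ = 0` and `ρ = 0` off the support disc. [cite: Forster1981, §20.5, proof (a)] -/
theorem delAlong_cutoff_eq_zero_of_notMem_tsupport {z : ℂ} (hz : z ∉ tsupport A.cutoff) :
    delAlong 1 A.cutoff z = 0 := by
  rw [delAlong_eq_fderiv_sub_dbarAlong, dbarAlong_eq_zero_of_notMem_tsupport hz,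
    fderiv_of_notMem_tsupport ℝ hz, sub_zero]
  rfl

omit [IsManifold 𝓘(ℂ, ℂ) ω M] in
/-- `K` agrees with the raw coefficient near every point other than `a, b`.
[cite: Forster1981, §20.5, proof (a)] -/
theorem kappa_eventuallyEq_kappa₀ {z : ℂ} (h1 : z ≠ A.src) (h2 : z ≠ A.tgt) :
    A.kappa τ =ᶠ[𝓝 z] A.kappa₀ τ := by
  have hopen : IsOpen ({A.src, A.tgt}ᶜ : Set ℂ) := (Set.toFinite _).isClosed.isOpen_compl
  have hz : z ∈ ({A.src, A.tgt}ᶜ : Set ℂ) := by simp [h1, h2]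
  filter_upwards [hopen.mem_nhds hz] with w hw
  simp only [mem_compl_iff, mem_insert_iff, mem_singleton_iff, not_or] at hw
  simp [kappa, hw.1, hw.2]

variable {A} in
/-- **`K` is analytic at `b`**: near `b`, `K = -dslope G b - (z - a)⁻¹` with `τ_{z_p} = (z-b)⁻¹ G`,
`G(b) = 1` (the principal parts of `λ` and `τ_{z_p}` cancel). [cite: Forster1981, §20.5, proof (a)] -/
theorem ThirdKindFor.exists_analyticAt_kappa_tgt (hτ : A.ThirdKindFor τ) :
    ∃ Φ : ℂ → ℂ, AnalyticAt ℂ Φ A.tgt ∧ A.kappa τ =ᶠ[𝓝 A.tgt] Φ := by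
  obtain ⟨G, hGa, hG1, hG⟩ := hτ.exists_eventuallyEq_tgt
  set Φ : ℂ → ℂ := fun z ↦ -dslope G A.tgt z - (z - A.src)⁻¹ with hΦ
  have hba : A.tgt ≠ A.src := A.src_ne_tgt.symm
  have hΦa : AnalyticAt ℂ Φ A.tgt :=
    (AnalyticAt.dslope' hGa).neg.sub ((analyticAt_id.sub analyticAt_const).inv (sub_ne_zero.2 hba))
  -- on a punctured neighbourhood of `b`, `K = κ₀ = Φ`
  have hpunct : ∀ᶠ z in 𝓝[≠] A.tgt, A.kappa₀ τ z = Φ z := by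
    have h1 : ∀ᶠ z in 𝓝[≠] A.tgt, A.cutoff z = 1 :=
      (A.cutoff_eventuallyEq_one A.tgt_mem_ball_r₂).filter_mono nhdsWithin_le_nhds
    filter_upwards [hG, h1, self_mem_nhdsWithin] with z hz hρ hzb
    have hzb' : z ≠ A.tgt := hzb
    simp only [hΦ]
    rw [kappa₀, hz, hρ, one_mul, lam, dslope_of_ne _ hzb', slope_def_field, hG1]
    have hzb'' : z - A.tgt ≠ 0 := sub_ne_zero.2 hzb'
    field_simp
    ring
  refine ⟨Φ, hΦa, ?_⟩
  -- the value at `b` is the punctured limit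
  have hlim : limUnder (𝓝[≠] A.tgt) (A.kappa₀ τ) = Φ A.tgt :=
    ((hΦa.continuousAt.tendsto.mono_left nhdsWithin_le_nhds).congr' (hpunct.mono fun z hz ↦ hz.symm)).limUnder_eq
  have hpunct' : ∀ᶠ z in 𝓝 A.tgt, z ≠ A.tgt → A.kappa₀ τ z = Φ z :=
    eventually_nhdsWithin_iff.1 hpunct
  have hne : ∀ᶠ z in 𝓝 A.tgt, z ≠ A.src := isOpen_ne.mem_nhds hba
  filter_upwards [hpunct', hne] with z hz hza
  by_cases hzb : z = A.tgt
  · subst hzb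
    simp [kappa, hlim]
  · simp [kappa, hzb, hza, hz hzb]

variable {A} in
/-- **`K` is analytic at `a`**: near `a`, `K = (z - b)⁻¹ - dslope G a` with `τ_{z_p} = (z-a)⁻¹ G`,
`G(a) = -1`. [cite: Forster1981, §20.5, proof (a)] -/
theorem ThirdKindFor.exists_analyticAt_kappa_src (hτ : A.ThirdKindFor τ) :
    ∃ Φ : ℂ → ℂ, AnalyticAt ℂ Φ A.src ∧ A.kappa τ =ᶠ[𝓝 A.src] Φ := by
  obtain ⟨G, hGa, hG1, hG⟩ := hτ.exists_eventuallyEq_src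
  set Φ : ℂ → ℂ := fun z ↦ (z - A.tgt)⁻¹ - dslope G A.src z with hΦ
  have hab : A.src ≠ A.tgt := A.src_ne_tgt
  have hΦa : AnalyticAt ℂ Φ A.src :=
    ((analyticAt_id.sub analyticAt_const).inv (sub_ne_zero.2 hab)).sub (AnalyticAt.dslope' hGa)
  have hpunct : ∀ᶠ z in 𝓝[≠] A.src, A.kappa₀ τ z = Φ z := by
    have h1 : ∀ᶠ z in 𝓝[≠] A.src, A.cutoff z = 1 :=
      (A.cutoff_eventuallyEq_one A.src_mem_ball_r₂).filter_mono nhdsWithin_le_nhds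
    filter_upwards [hG, h1, self_mem_nhdsWithin] with z hz hρ hza
    have hza' : z ≠ A.src := hza
    simp only [hΦ]
    rw [kappa₀, hz, hρ, one_mul, lam, dslope_of_ne _ hza', slope_def_field, hG1]
    have hza'' : z - A.src ≠ 0 := sub_ne_zero.2 hza'
    field_simp
    ring
  refine ⟨Φ, hΦa, ?_⟩
  have hlim : limUnder (𝓝[≠] A.src) (A.kappa₀ τ) = Φ A.src :=
    ((hΦa.continuousAt.tendsto.mono_left nhdsWithin_le_nhds).congr' (hpunct.mono fun z hz ↦ hz.symm)).limUnder_eq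
  have hpunct' : ∀ᶠ z in 𝓝 A.src, z ≠ A.src → A.kappa₀ τ z = Φ z :=
    eventually_nhdsWithin_iff.1 hpunct
  have hne : ∀ᶠ z in 𝓝 A.src, z ≠ A.tgt := isOpen_ne.mem_nhds hab
  filter_upwards [hpunct', hne] with z hz hzb
  by_cases hza : z = A.src
  · subst hza
    simp [kappa, hlim]
  · simp [kappa, hzb, hza, hz hza]

variable {A} in
/-- **`K` is analytic on the disc `B(c₀, r₂)`** (there `ρ = 1` and `K = λ - τ_{z_p}` with the poles
removed). [cite: Forster1981, §20.5, proof (a)] -/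
theorem ThirdKindFor.analyticAt_kappa (hτ : A.ThirdKindFor τ) {z : ℂ} (hz : z ∈ ball A.c₀ A.r₂) :
    AnalyticAt ℂ (A.kappa τ) z := by
  by_cases h2 : z = A.tgt
  · subst h2
    obtain ⟨Φ, hΦ, heq⟩ := hτ.exists_analyticAt_kappa_tgt
    exact hΦ.congr heq.symm
  by_cases h1 : z = A.src
  · subst h1
    obtain ⟨Φ, hΦ, heq⟩ := hτ.exists_analyticAt_kappa_src
    exact hΦ.congr heq.symm
  have hev : A.kappa τ =ᶠ[𝓝 z] fun w ↦ A.lam w - τ.localExpr (chartAt ℂ A.center) w := by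
    filter_upwards [A.kappa_eventuallyEq_kappa₀ (τ := τ) h1 h2, A.cutoff_eventuallyEq_one hz]
      with w hw hρ
    rw [hw, kappa₀, hρ, one_mul]
  refine AnalyticAt.congr ?_ hev.symm
  exact (A.analyticAt_lam h1 h2).sub (hτ.analyticAt_localExpr (A.ball_r₂_subset_target hz) h1 h2)

variable {A} in
/-- **`K` is `C^∞` at every point of the chart target.** [cite: Forster1981, §20.5, proof (a)] -/
theorem ThirdKindFor.contDiffAt_kappa (hτ : A.ThirdKindFor τ) {z : ℂ}
    (hz : z ∈ (chartAt ℂ A.center).target) : ContDiffAt ℝ ∞ (A.kappa τ) z := by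
  by_cases hb : z ∈ ball A.c₀ A.r₂
  · exact (hτ.analyticAt_kappa hb).contDiffAt.restrict_scalars ℝ
  have hzs := A.not_mem_segment_of_not_mem_ball hb
  have h1 : z ≠ A.src := fun h ↦ hb (h ▸ A.src_mem_ball_r₂)
  have h2 : z ≠ A.tgt := fun h ↦ hb (h ▸ A.tgt_mem_ball_r₂)
  refine ContDiffAt.congr_of_eventuallyEq ?_ (A.kappa_eventuallyEq_kappa₀ h1 h2)
  have hlam : ContDiffAt ℝ ∞ A.lam z :=
    (A.analyticAt_lam h1 h2).contDiffAt.restrict_scalars ℝ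
  have hτc : ContDiffAt ℝ ∞ (τ.localExpr (chartAt ℂ A.center)) z :=
    (hτ.analyticAt_localExpr hz h1 h2).contDiffAt.restrict_scalars ℝ
  exact (A.contDiff_cutoff.contDiffAt.mul hlam).sub hτc

variable {A} in
/-- **`∂̄K = λ ∂̄ρ` on the chart target** (off the disc `K = ρλ - τ_{z_p}` with `λ`, `τ_{z_p}`
holomorphic; on the disc both sides vanish). [cite: Forster1981, §20.5, proof (a)] -/
theorem ThirdKindFor.dbarAlong_kappa (hτ : A.ThirdKindFor τ) {z : ℂ}
    (hz : z ∈ (chartAt ℂ A.center).target) :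
    dbarAlong 1 (A.kappa τ) z = A.lam z * dbarAlong 1 A.cutoff z := by
  by_cases hb : z ∈ ball A.c₀ A.r₂
  · rw [dbarAlong_eq_zero_of_differentiableAt (hτ.analyticAt_kappa hb).differentiableAt 1,
      A.dbarAlong_cutoff_eq_zero hb, mul_zero]
  have h1 : z ≠ A.src := fun h ↦ hb (h ▸ A.src_mem_ball_r₂)
  have h2 : z ≠ A.tgt := fun h ↦ hb (h ▸ A.tgt_mem_ball_r₂)
  have hρd : DifferentiableAt ℝ A.cutoff z := A.contDiff_cutoff.contDiffAt.differentiableAt (by simp)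
  have hlamC : DifferentiableAt ℂ A.lam z := A.differentiableAt_lam h1 h2
  have hτC : DifferentiableAt ℂ (τ.localExpr (chartAt ℂ A.center)) z :=
    (hτ.analyticAt_localExpr hz h1 h2).differentiableAt
  have hmul : DifferentiableAt ℝ (fun w ↦ A.cutoff w * A.lam w) z :=
    hρd.mul (hlamC.restrictScalars ℝ)
  have hτR : DifferentiableAt ℝ (fun w ↦ τ.localExpr (chartAt ℂ A.center) w) z :=
    hτC.restrictScalars ℝ
  rw [dbarAlong_congr_of_eventuallyEq (A.kappa_eventuallyEq_kappa₀ h1 h2) 1]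
  change dbarAlong 1 (fun w ↦ A.cutoff w * A.lam w - τ.localExpr (chartAt ℂ A.center) w) z = _
  rw [dbarAlong_sub hmul hτR 1, dbarAlong_eq_zero_of_differentiableAt hτC 1, sub_zero,
    dbarAlong_one_mul hρd (hlamC.restrictScalars ℝ), dbarAlong_eq_zero_of_differentiableAt hlamC 1,
    mul_zero, add_zero, mul_comm]

/-! ### §4 The `(1,0)`-coefficient `P̃ = w ∂ρ + (2πi)⁻¹ K` and the closedness identity `∂q = ∂̄P̃` -/

/-- **The chart coefficient `P̃ = w_{a,b} ∂ρ + (2πi)⁻¹ K` against `dz_p`** of the closed form of the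
arc. [cite: Forster1981, §20.5, proof (a)] -/
def Ptilde (τ : MeromorphicOneForm M) : ℂ → ℂ := fun z ↦
  arcLog A.src A.tgt z * delAlong 1 A.cutoff z + (2 * π * I)⁻¹ * A.kappa τ z

omit [IsManifold 𝓘(ℂ, ℂ) ω M] in
/-- `w_{a,b} · ∂ρ` is `C^∞` (it vanishes on the disc containing the cut). [cite: Forster1981, §20.5, proof (a)] -/
theorem contDiff_arcLog_mul_delAlong_cutoff :
    ContDiff ℝ ∞ fun z ↦ arcLog A.src A.tgt z * delAlong 1 A.cutoff z := by
  rw [contDiff_iff_contDiffAt]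
  intro z
  by_cases hz : z ∈ ball A.c₀ A.r₂
  · have h0 : (fun z ↦ arcLog A.src A.tgt z * delAlong 1 A.cutoff z) =ᶠ[𝓝 z] fun _ ↦ 0 := by
      filter_upwards [isOpen_ball.mem_nhds hz] with y hy
      rw [A.delAlong_cutoff_eq_zero hy, mul_zero]
    exact contDiffAt_const.congr_of_eventuallyEq h0
  · exact (contDiffAt_arcLog (A.not_mem_segment_of_not_mem_ball hz)).mul
      (contDiff_delAlong A.contDiff_cutoff).contDiffAt

omit [IsManifold 𝓘(ℂ, ℂ) ω M] in
/-- `w_{a,b} · ∂ρ` vanishes on the disc `B(c₀, r₂)`. [cite: Forster1981, §20.5, proof (a)] -/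
theorem arcLog_mul_delAlong_cutoff_eq_zero {z : ℂ} (hz : z ∈ ball A.c₀ A.r₂) :
    arcLog A.src A.tgt z * delAlong 1 A.cutoff z = 0 := by
  rw [A.delAlong_cutoff_eq_zero hz, mul_zero]

variable {A} in
/-- **`P̃` is `C^∞` on the chart target.** [cite: Forster1981, §20.5, proof (a)] -/
theorem ThirdKindFor.contDiffAt_Ptilde (hτ : A.ThirdKindFor τ) {z : ℂ}
    (hz : z ∈ (chartAt ℂ A.center).target) : ContDiffAt ℝ ∞ (A.Ptilde τ) z :=
  A.contDiff_arcLog_mul_delAlong_cutoff.contDiffAt.add (contDiffAt_const.mul (hτ.contDiffAt_kappa hz))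

variable {A} in
/-- **The closedness identity `∂q = ∂̄P̃` on the chart target** (Forster 9.13: `d(P̃ dz + q dz̄) = 0`
iff `∂q = ∂̄P̃`), where `q = ∂̄ρ · w_{a,b}` is the coefficient of `σ`: both sides equal
`w ∂∂̄ρ + (2πi)⁻¹ λ ∂̄ρ` off the disc (by `w′ = (2πi)⁻¹λ`, `∂̄K = λ∂̄ρ` and `∂∂̄ = ∂̄∂`), and vanish on
it. [cite: Forster1981, §20.5, proof (a)] -/
theorem ThirdKindFor.delAlong_coeff_eq_dbarAlong_Ptilde (hτ : A.ThirdKindFor τ) {z : ℂ}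
    (hz : z ∈ (chartAt ℂ A.center).target) :
    delAlong 1 A.coeff z = dbarAlong 1 (A.Ptilde τ) z := by
  by_cases hb : z ∈ ball A.c₀ A.r₂
  · -- on the disc: `q = 0` near `z`, `P̃ = (2πi)⁻¹ K` near `z` with `K` analytic
    have hq : A.coeff =ᶠ[𝓝 z] fun _ ↦ 0 := by
      filter_upwards [isOpen_ball.mem_nhds hb] with w hw using A.coeff_eq_zero_of_mem hw
    have hP : A.Ptilde τ =ᶠ[𝓝 z] fun w ↦ (2 * π * I)⁻¹ * A.kappa τ w := by
      filter_upwards [isOpen_ball.mem_nhds hb] with w hw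
      rw [Ptilde, A.arcLog_mul_delAlong_cutoff_eq_zero hw, zero_add]
    rw [delAlong_congr_of_eventuallyEq hq, delAlong_const', dbarAlong_congr_of_eventuallyEq hP 1,
      dbarAlong_const_mul' ((hτ.analyticAt_kappa hb).differentiableAt.restrictScalars ℝ),
      dbarAlong_eq_zero_of_differentiableAt (hτ.analyticAt_kappa hb).differentiableAt 1, mul_zero]
  · -- off the disc
    have hzs := A.not_mem_segment_of_not_mem_ball hb
    have hρ2 : ContDiffAt ℝ 2 A.cutoff z :=
      A.contDiff_cutoff.contDiffAt.of_le (WithTop.coe_le_coe.2 le_top)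
    have hρd : DifferentiableAt ℝ A.cutoff z := A.contDiff_cutoff.contDiffAt.differentiableAt (by simp)
    have hdbarρ : DifferentiableAt ℝ (dbarAlong 1 A.cutoff) z :=
      (contDiff_infty_dbarAlong A.contDiff_cutoff 1).contDiffAt.differentiableAt (by simp)
    have hdelρ : DifferentiableAt ℝ (delAlong 1 A.cutoff) z :=
      (contDiff_delAlong A.contDiff_cutoff).contDiffAt.differentiableAt (by simp)
    have hwC : DifferentiableAt ℂ (arcLog A.src A.tgt) z := differentiableAt_arcLog hzs
    have hw : DifferentiableAt ℝ (arcLog A.src A.tgt) z := hwC.restrictScalars ℝ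
    have hK : DifferentiableAt ℝ (A.kappa τ) z := (hτ.contDiffAt_kappa hz).differentiableAt (by simp)
    -- left side
    have hL : delAlong 1 A.coeff z =
        delAlong 1 (dbarAlong 1 A.cutoff) z * arcLog A.src A.tgt z +
          dbarAlong 1 A.cutoff z * ((2 * π * I)⁻¹ * A.lam z) := by
      change delAlong 1 (fun w ↦ dbarAlong 1 A.cutoff w * arcLog A.src A.tgt w) z = _
      rw [delAlong_one_mul hdbarρ hw, delAlong_eq_deriv_of_differentiableAt hwC, A.deriv_arcLog_eq hzs]
    -- right side
    have hR : dbarAlong 1 (A.Ptilde τ) z =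
        arcLog A.src A.tgt z * dbarAlong 1 (delAlong 1 A.cutoff) z +
          (2 * π * I)⁻¹ * (A.lam z * dbarAlong 1 A.cutoff z) := by
      have hA : DifferentiableAt ℝ (fun w ↦ arcLog A.src A.tgt w * delAlong 1 A.cutoff w) z :=
        hw.mul hdelρ
      have hB : DifferentiableAt ℝ (fun w ↦ (2 * π * I)⁻¹ * A.kappa τ w) z :=
        (differentiableAt_const _).mul hK
      change dbarAlong 1 (fun w ↦ arcLog A.src A.tgt w * delAlong 1 A.cutoff w +
        (2 * π * I)⁻¹ * A.kappa τ w) z = _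
      rw [dbarAlong_fun_add hA hB 1, dbarAlong_one_mul hw hdelρ,
        dbarAlong_eq_zero_of_differentiableAt hwC 1, zero_mul, zero_add,
        dbarAlong_const_mul' hK, hτ.dbarAlong_kappa hz]
    rw [hL, hR, delAlong_dbarAlong_comm hρ2 le_rfl]
    ring

/-! ### §5 The closed form `β = P dz + σ` of the arc -/

open Classical in
/-- **The coefficient `P` (against `dz_x`) of the `(1,0)`-part of the closed form of the arc**: on the
chart source the form `P̃ dz_p` re-expressed against `dz_x`; off it, `-(2πi)⁻¹ τ`.
[cite: Forster1981, §20.5, proof (a)] -/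
def coeffP (τ : MeromorphicOneForm M) : M → ℂ := fun x ↦
  if x ∈ (chartAt ℂ A.center).source then chartCoeff A.center (A.Ptilde τ) x
  else -(2 * π * I)⁻¹ * τ x

/-- **The closed form `β = P dz + σ` of the arc.** On `M ∖ {a', b'}` it is
`(2πi)⁻¹ (f⁻¹ df - τ)` for the weak solution `f` (Forster: `(2πi)⁻¹ f⁻¹ df` has `(0,1)`-part `σ`;
the differential of the third kind `τ` removes the poles of its `(1,0)`-part at the endpoints).
[cite: Forster1981, §20.5, proof (a)] -/
def closedForm (τ : MeromorphicOneForm M) : MForm 𝓘(ℝ, ℂ) M ℂ 1 := oneZeroForm (A.coeffP τ) + A.form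

omit [IsManifold 𝓘(ℂ, ℂ) ω M] in
/-- `P` on the chart source. [cite: Forster1981, §20.5, proof (a)] -/
theorem coeffP_of_mem {x : M} (hx : x ∈ (chartAt ℂ A.center).source) :
    A.coeffP τ x = chartCoeff A.center (A.Ptilde τ) x := by
  simp [coeffP, hx]

omit [IsManifold 𝓘(ℂ, ℂ) ω M] in
/-- `P` off the chart source. [cite: Forster1981, §20.5, proof (a)] -/
theorem coeffP_of_not_mem {x : M} (hx : x ∉ (chartAt ℂ A.center).source) :
    A.coeffP τ x = -(2 * π * I)⁻¹ * τ x := by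
  simp [coeffP, hx]

omit [IsManifold 𝓘(ℂ, ℂ) ω M] in
/-- `β = P dz + σ` (definitional). [cite: Forster1981, §20.5, proof (a)] -/
theorem closedForm_eq : A.closedForm τ = oneZeroForm (A.coeffP τ) + A.form := rfl

omit [IsManifold 𝓘(ℂ, ℂ) ω M] in
/-- The `(0,1)`-part of `β` is `σ`: `coeffZeroOne β = chartCoeffBar p g`. [cite: Forster1981, §20.5, proof (a)] -/
theorem coeffZeroOne_closedForm : coeffZeroOne (A.closedForm τ) = chartCoeffBar A.center A.coeff := by
  rw [closedForm, coeffZeroOne_add, coeffZeroOne_oneZeroForm, zero_add, form_def, coeffZeroOne_zeroOneForm]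

/-- The local expression of `P` in the chart `z_p` is `P̃`. [cite: Forster1981, §20.5, proof (a)] -/
theorem localExpr_coeffP {y : ℂ} (hy : y ∈ (chartAt ℂ A.center).target) :
    localExpr (A.coeffP τ) (chartAt ℂ A.center) y = A.Ptilde τ y := by
  rw [localExpr_apply, A.coeffP_of_mem ((chartAt ℂ A.center).map_target hy), ← localExpr_apply,
    localExpr_chartCoeff _ hy]

variable [IsManifold 𝓘(ℝ, ℂ) ∞ M]

/-- **The chart representative of `β` on the target of `z_p` is `P̃ dz + q dz̄`.**
[cite: Forster1981, §20.5, proof (a)] -/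
theorem inChart_closedForm {y : ℂ} (hy : y ∈ (chartAt ℂ A.center).target) :
    (A.closedForm τ).inChart A.center y =
      (A.Ptilde τ y • dzForm + A.coeff y • dzbarForm : ℂ [⋀^Fin 1]→L[ℝ] ℂ) := by
  rw [closedForm, MForm.inChart_add, Pi.add_apply, inChart_oneZeroForm _ hy, A.localExpr_coeffP hy, form_def,
    inChart_zeroOneForm_chartCoeffBar _ hy]

omit [IsManifold 𝓘(ℝ, ℂ) ∞ M] in
/-- **Off the chart, `β = -(2πi)⁻¹ τ` near every point** (there `ρ = 0`, `σ = 0`, `K = -τ_{z_p}`).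
[cite: Forster1981, §20.5, proof (a)] -/
theorem closedForm_eventuallyEq_of_not_mem [T2Space M] {x : M}
    (hx : x ∉ (chartAt ℂ A.center).source) :
    ∀ᶠ x' in 𝓝 x, A.closedForm τ x' = oneZeroForm (fun y ↦ -(2 * π * I)⁻¹ * τ y) x' := by
  set e := chartAt ℂ A.center with he
  set C : Set M := e.symm '' closedBall A.c₀ A.r₃ with hC
  have hCc : IsCompact C := (isCompact_closedBall _ _).image_of_continuousOn
    (e.continuousOn_symm.mono ((closedBall_subset_ball A.r₃_lt_R).trans A.ball_subset_target))
  have hxC : x ∉ C := by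
    rintro ⟨z, hz, rfl⟩
    exact hx (e.map_target (A.ball_subset_target (closedBall_subset_ball A.r₃_lt_R hz)))
  filter_upwards [hCc.isClosed.isOpen_compl.mem_nhds hxC] with x' hx'
  -- the two coefficients at `x'`
  have hQ : chartCoeffBar A.center A.coeff x' = 0 := by
    by_cases hs : x' ∈ e.source
    · have hz : e x' ∉ closedBall A.c₀ A.r₃ := fun h ↦ hx' ⟨e x', h, e.left_inv hs⟩
      have hz' : e x' ∉ tsupport A.coeff := fun h ↦ hz (A.tsupport_coeff_subset.trans
        A.tsupport_cutoff_subset h)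
      exact chartCoeffBar_eq_zero_of_apply_eq_zero (image_eq_zero_of_notMem_tsupport hz')
    · exact chartCoeffBar_of_notMem _ hs
  have hP : A.coeffP τ x' = -(2 * π * I)⁻¹ * τ x' := by
    by_cases hs : x' ∈ e.source
    · have hz : e x' ∉ closedBall A.c₀ A.r₃ := fun h ↦ hx' ⟨e x', h, e.left_inv hs⟩
      have hzρ : e x' ∉ tsupport A.cutoff := fun h ↦ hz (A.tsupport_cutoff_subset h)
      have h1 : e x' ≠ A.src := fun h ↦ hz (h ▸ ball_subset_closedBall
        (ball_subset_ball (A.r₂_lt_r₃).le A.src_mem_ball_r₂))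
      have h2 : e x' ≠ A.tgt := fun h ↦ hz (h ▸ ball_subset_closedBall
        (ball_subset_ball (A.r₂_lt_r₃).le A.tgt_mem_ball_r₂))
      have hK : A.kappa τ (e x') = -τ.localExpr e (e x') := by
        rw [(A.kappa_eventuallyEq_kappa₀ (τ := τ) h1 h2).self_of_nhds, kappa₀,
          image_eq_zero_of_notMem_tsupport hzρ, zero_mul, zero_sub]
      have hT : deriv (chartAt ℂ x' ∘ e.symm) (e x') ≠ 0 := by
        have := deriv_chartAt_comp_symm_ne_zero (M := M) (e.map_source hs)
        rwa [e.left_inv hs] at this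
      rw [A.coeffP_of_mem hs, chartCoeff_of_mem _ hs, Ptilde,
        A.delAlong_cutoff_eq_zero_of_notMem_tsupport hzρ, mul_zero, zero_add, hK,
        MeromorphicOneForm.localExpr, localExpr_apply, e.left_inv hs]
      have hTe : deriv (chartAt ℂ x' ∘ (chartAt ℂ A.center).symm) (chartAt ℂ A.center x') =
          deriv (chartAt ℂ x' ∘ e.symm) (e x') := rfl
      rw [hTe]
      field_simp
    · exact A.coeffP_of_not_mem hs
  change (A.coeffP τ x' • dzForm + chartCoeffBar A.center A.coeff x' • dzbarForm :
      ℂ [⋀^Fin 1]→L[ℝ] ℂ) = ((-(2 * π * I)⁻¹ * τ x') • dzForm : ℂ [⋀^Fin 1]→L[ℝ] ℂ)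
  rw [hP, hQ, zero_smul ℂ (dzbarForm : ℂ [⋀^Fin 1]→L[ℝ] ℂ), add_zero]

omit [IsManifold 𝓘(ℂ, ℂ) ω M] [IsManifold 𝓘(ℝ, ℂ) ∞ M] in
/-- The local expression of `c · η` in any chart is `c · η_e`. [cite: Miranda1995, Chapter IV Definition 1.7] -/
theorem localExpr_const_mul (η : MeromorphicOneForm M) (c : ℂ) (e : OpenPartialHomeomorph M ℂ) :
    localExpr (fun y ↦ c * η y) e = fun w ↦ c * η.localExpr e w := by
  funext w
  rw [localExpr_apply, MeromorphicOneForm.localExpr, localExpr_apply]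
  ring

variable {A} in
/-- **`β` is a smooth form.** [cite: Forster1981, §20.5, proof (a)] -/
theorem ThirdKindFor.isSmoothForm_closedForm [T2Space M] (hτ : A.ThirdKindFor τ) :
    IsSmoothForm (A.closedForm τ) := by
  rw [isSmoothForm_iff_smoothAt]
  intro x
  by_cases hx : x ∈ (chartAt ℂ A.center).source
  · have hx' : x ∈ (extChartAt 𝓘(ℝ, ℂ) A.center).source := by simpa using hx
    refine MForm.smoothAt_of_contDiffWithinAt_inChart hx' ?_
    rw [ModelWithCorners.Boundaryless.range_eq_univ, contDiffWithinAt_univ]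
    have hpx : extChartAt 𝓘(ℝ, ℂ) A.center x = chartAt ℂ A.center x := by simp
    rw [hpx]
    have hy : chartAt ℂ A.center x ∈ (chartAt ℂ A.center).target :=
      (chartAt ℂ A.center).map_source hx
    have hev : (A.closedForm τ).inChart A.center =ᶠ[𝓝 (chartAt ℂ A.center x)]
        fun y ↦ (A.Ptilde τ y • dzForm + A.coeff y • dzbarForm : ℂ [⋀^Fin 1]→L[ℝ] ℂ) := by
      filter_upwards [(chartAt ℂ A.center).open_target.mem_nhds hy] with y hy'
      exact A.inChart_closedForm hy'
    refine ContDiffAt.congr_of_eventuallyEq ?_ hev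
    exact ((hτ.contDiffAt_Ptilde hy).smul contDiffAt_const).add
      (A.contDiff_coeff.contDiffAt.smul contDiffAt_const)
  · have hne1 : x ≠ A.srcPt := fun h ↦ hx (h ▸ A.srcPt_mem_source)
    have hne2 : x ≠ A.tgtPt := fun h ↦ hx (h ▸ A.tgtPt_mem_source)
    have hγ : (oneZeroForm (fun y ↦ -(2 * π * I)⁻¹ * τ y) : MForm 𝓘(ℝ, ℂ) M ℂ 1).SmoothAt x := by
      refine smoothAt_oneZeroForm ?_
      rw [localExpr_const_mul τ]
      exact contDiffAt_const.mul ((hτ.holo x hne1 hne2).contDiffAt.restrict_scalars ℝ)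
    exact hγ.congr_of_eventuallyEq ((A.closedForm_eventuallyEq_of_not_mem hx).mono fun _ h ↦ h.symm)

variable {A} in
/-- **`β` is closed: `dβ = 0` everywhere.** On the chart this is `∂q = ∂̄P̃`
(`delAlong_coeff_eq_dbarAlong_Ptilde`); off it, `β = -(2πi)⁻¹ τ` is a holomorphic `(1,0)`-form.
[cite: Forster1981, §20.5, proof (a)] -/
theorem ThirdKindFor.mextDeriv_closedForm [T2Space M] (hτ : A.ThirdKindFor τ) (x : M) :
    mextDeriv (A.closedForm τ) x = 0 := by
  have hsm := (isSmoothForm_iff_smoothAt _).1 hτ.isSmoothForm_closedForm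
  by_cases hx : x ∈ (chartAt ℂ A.center).source
  · have hy : chartAt ℂ A.center x ∈ (chartAt ℂ A.center).target :=
      (chartAt ℂ A.center).map_source hx
    have hev : (A.closedForm τ).inChart A.center =ᶠ[𝓝 (chartAt ℂ A.center x)]
        fun y ↦ (A.Ptilde τ y • dzForm + A.coeff y • dzbarForm : ℂ [⋀^Fin 1]→L[ℝ] ℂ) := by
      filter_upwards [(chartAt ℂ A.center).open_target.mem_nhds hy] with y hy'
      exact A.inChart_closedForm hy'
    exact mextDeriv_eq_zero_of_inChart_eventuallyEq hx (hsm x) hev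
      ((hτ.contDiffAt_Ptilde hy).differentiableAt (by simp))
      (A.contDiff_coeff.contDiffAt.differentiableAt (by simp))
      (hτ.delAlong_coeff_eq_dbarAlong_Ptilde hy)
  · have hne1 : x ≠ A.srcPt := fun h ↦ hx (h ▸ A.srcPt_mem_source)
    have hne2 : x ≠ A.tgtPt := fun h ↦ hx (h ▸ A.tgtPt_mem_source)
    rw [mextDeriv_congr_of_eventuallyEq (A.closedForm_eventuallyEq_of_not_mem hx)]
    set γ : MForm 𝓘(ℝ, ℂ) M ℂ 1 := oneZeroForm (fun y ↦ -(2 * π * I)⁻¹ * τ y) with hγ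
    set Pₓ : ℂ → ℂ := fun w ↦ -(2 * π * I)⁻¹ * τ.localExpr (chartAt ℂ x) w with hPₓ
    have han : AnalyticAt ℂ Pₓ (chartAt ℂ x x) := analyticAt_const.mul (hτ.holo x hne1 hne2)
    have hγs : γ.SmoothAt x := by
      refine smoothAt_oneZeroForm ?_
      rw [localExpr_const_mul τ]
      exact han.contDiffAt.restrict_scalars ℝ
    have hev : γ.inChart x =ᶠ[𝓝 (chartAt ℂ x x)]
        fun y ↦ (Pₓ y • dzForm + (fun _ ↦ (0 : ℂ)) y • dzbarForm : ℂ [⋀^Fin 1]→L[ℝ] ℂ) := by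
      filter_upwards [(chartAt ℂ x).open_target.mem_nhds (mem_chart_target ℂ x)] with y hy
      rw [hγ, inChart_oneZeroForm _ hy, localExpr_const_mul τ,
        zero_smul ℂ (dzbarForm : ℂ [⋀^Fin 1]→L[ℝ] ℂ), add_zero]
    refine mextDeriv_eq_zero_of_inChart_eventuallyEq (mem_chart_source ℂ x) hγs hev
      (han.differentiableAt.restrictScalars ℝ) (differentiableAt_const _) ?_
    rw [delAlong_const', dbarAlong_eq_zero_of_differentiableAt han.differentiableAt 1]

/-- **The closed form of an arc (Forster 20.5 / 20.7, first step).** For an arc in a chart of a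
compact connected Riemann surface there is a smooth CLOSED complex `1`-form `β` whose `(0,1)`-part is
the form `σ` of the arc: `β = P dz + σ` for a coefficient function `P`. (Forster obtains `σ = d″ψ`
from Dolbeault's lemma 19.10; the tree replaces this by the de Rham decomposition of `H¹`, which needs
a closed completion of `σ` — supplied here by `(2πi)⁻¹(f⁻¹df - τ)`, `τ` of the third kind.)
[cite: Forster1981, §20.5 and Theorem 20.7 (proof)] -/
theorem exists_closedForm [CompactSpace M] [T2Space M] [PreconnectedSpace M] [Nonempty M] :
    ∃ β : MForm 𝓘(ℝ, ℂ) M ℂ 1, IsSmoothForm β ∧ (∀ x, mextDeriv β x = 0) ∧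
      ∃ P : M → ℂ, β = oneZeroForm P + A.form := by
  obtain ⟨τ, hτ⟩ := A.exists_thirdKindFor
  exact ⟨A.closedForm τ, hτ.isSmoothForm_closedForm, hτ.mextDeriv_closedForm, A.coeffP τ, rfl⟩

end ArcDatum

end RiemannSurface

end Literature.Geometry.Kaehler

end
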